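import Mathlib
import Literature.MathematicalPhysics.MHD.CerfonFreidbergSolutions
import Summits.Ventures.FusionMHD.Models.SolovevPCF
import HarnessLib

/-!
# Ventures/FusionMHD — Models/CerfonFreidbergNstxLike.lean: the Cerfon–Freidberg «NSTX-like» companion instance
# (α = 0, shape triple (39/50, 2, 7/20), ERRATUM-corrected boundary fit) as a typed predicate

HONEST FRAMING (LADDER-GRIDFUSION three columns). MODELLED: the ANALYTIC Cerfon–Freidberg equilibrium family
`U = U_P + Σ c_j U_j` (Freidberg 2014 (6.151)/(6.153); `Literature/…/CerfonFreidbergSolutions.lean`) with Solov'ev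
profiles, `α = 0`, fitted to the printed NSTX-like triple `(ε, κ, δ) = (39/50, 2, 7/20)` of Pataki–Cerfon–Freidberg
2013 §6.1 by the seven constraints (6.155) WITH THE BRACKET VALUES of (6.156) (`IsBoundaryFitGeom`, erratum p490998 /
osculation theorems p494255) — the twin of the ITER-like instance of record `Models/CerfonFreidbergIterLike.lean` (p495389) on
the second shape triple of record (the PCF NSTX-like shape of `Models/SolovevPCF.lean`), so that the CF rung carries both
instances like the PCF rung.  CERTIFIED content (kernel, this file): the defining predicate and its formal consequences
(every instance solves `Δ*U = X²` on `X > 0`).  Existence / uniqueness / enclosures: `Models/CerfonFreidbergNstxLikeKrawczyk.lean`.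
Typer/prover: gridfusion-model-5 (g5), 2026-08-27.  Citations: Freidberg 2014 §6.6.1 (6.150)–(6.156) [Freidberg2014];
Pataki–Cerfon–Freidberg 2013 §6.1 [PatakiCerfonFreidberg2013].
-/

noncomputable section

namespace Summit.Ventures.FusionMHD.Models.CFNstxLike

open Literature.MathematicalPhysics.MHD Literature.MathematicalPhysics.MHD.GradShafranov
  Literature.MathematicalPhysics.MHD.CerfonFreidberg _root_.Real

/-- Inverse aspect ratio of the reference surface, `ε = 39/50` (PCF 2013 §6.1 «NSTX-like»). -/
def ε : ℝ := 39 / 50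
/-- Elongation of the reference surface, `κ = 2`. -/
def κ : ℝ := 2
/-- Triangularity of the reference surface, `δ = sin δ₀ = 7/20`. -/
def δ : ℝ := 7 / 20
/-- `δ₀ = arcsin δ` (transcendental; the curvature coefficients `N₁, N₂` of (6.156) are therefore not rational). -/
def δ₀ : ℝ := Real.arcsin δ
/-- The Solov'ev mixing parameter, `α = 0` (`A = 0`: `Δ*U = X²`, the PCF profiles) — as for the ITER-like instance of record. -/
def α : ℝ := 0

/-- THE INSTANCE OF RECORD as a predicate on a flux function `U(X, Y)`: `U` is a member of the up–down symmetric
Cerfon–Freidberg family with `α = 0` for SOME coefficient vector `c : Fin 7 → ℝ`, and satisfies the seven boundary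
constraints (6.155) on the NSTX-like reference surface with the BRACKET curvature values (`IsBoundaryFitGeom`).
MODELLED: analytic CF equilibrium; coefficients certified in `Models/CerfonFreidbergNstxLikeKrawczyk.lean`. -/
def IsInstance (U : ℝ → ℝ → ℝ) : Prop :=
  (∃ c : Fin 7 → ℝ, U = cfSolution α c) ∧ IsBoundaryFitGeom ε κ δ₀ U

/-- Every instance solves the normalised Solov'ev equation with `α = 0`, i.e. `Δ*U = X²`, on `{X > 0}`. -/
theorem isNormalisedSolovevSolutionOn_of_isInstance {U : ℝ → ℝ → ℝ} (h : IsInstance U) :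
    IsNormalisedSolovevSolutionOn {x : ℝ × ℝ | 0 < x.1} U α := by
  obtain ⟨⟨c, rfl⟩, -⟩ := h
  exact isNormalisedSolovevSolutionOn_cfSolution α c

/-- Concretely: `Δ*U = X²` at every point with `X > 0` (`α = 0`). -/
theorem gsOperator_of_isInstance {U : ℝ → ℝ → ℝ} (h : IsInstance U) {X : ℝ} (Y : ℝ) (hX : 0 < X) :
    gsOperator U X Y = X ^ 2 := by
  have := isNormalisedSolovevSolutionOn_of_isInstance h X Y hX
  rw [this]
  unfold α
  ring

/-- Every instance vanishes at the three printed boundary points `(1 ± ε, 0)`, `(1 − δε, κε)` = `(89/50, 0)`,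
`(11/50, 0)`, `(727/1000, 39/25)` (constraints 1, 3, 5; `sin δ₀ = δ` since `|δ| ≤ 1`). -/
theorem zero_at_constraint_points {U : ℝ → ℝ → ℝ} (h : IsInstance U) :
    U (89 / 50) 0 = 0 ∧ U (11 / 50) 0 = 0 ∧ U (727 / 1000) (39 / 25) = 0 := by
  obtain ⟨-, h1, -, h3, -, h5, -, -⟩ := h
  have hs : Real.sin δ₀ = δ := by
    unfold δ₀
    exact Real.sin_arcsin (by unfold δ; norm_num) (by unfold δ; norm_num)
  rw [hs] at h5
  refine ⟨?_, ?_, ?_⟩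
  · have e : (1 : ℝ) + ε = 89 / 50 := by unfold ε; norm_num
    rw [← e]; exact h1
  · have e : (1 : ℝ) - ε = 11 / 50 := by unfold ε; norm_num
    rw [← e]; exact h3
  · have e1 : (1 : ℝ) - δ * ε = 727 / 1000 := by unfold δ ε; norm_num
    have e2 : κ * ε = (39 : ℝ) / 25 := by unfold κ ε; norm_num
    rw [← e1, ← e2]; exact h5

/-- The equatorial curvature constraints an instance satisfies, in the typed closed forms: `U_YY = +N1·U_X` at the
outer point and `U_YY = +N2·U_X` at the inner point (the ERRATUM-corrected signs; `N1 > 0 > N2`). -/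
theorem curvature_constraints {U : ℝ → ℝ → ℝ} (h : IsInstance U) :
    dZZ U (1 + ε) 0 = N1 ε κ δ₀ * dR U (1 + ε) 0 ∧ dZZ U (1 - ε) 0 = N2 ε κ δ₀ * dR U (1 - ε) 0 := by
  obtain ⟨-, -, h2, -, h4, -, -, -⟩ := h
  exact ⟨h2, h4⟩

end Summit.Ventures.FusionMHD.Models.CFNstxLike
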